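import Mathlib
import HarnessLib
import Summits.AtomisticToContinuum.FouriersLaw.Theses.JunctionLocality
import Summits.AtomisticToContinuum.FouriersLaw.Theorems.JunctionLocalitySuperadditiveResistanceStubInsertionIdentity
import Summits.AtomisticToContinuum.FouriersLaw.Theorems.JunctionLocalitySuperadditiveResistanceStubJunctionCurvaturePairings

/-!
# Helper `helper_roughnessSplit` of line `thermalise-then-cut-probe-insertion` (crux stmt-AtomisticToContinuum-11748)

The EXACT fixed-`N` Hermite split of the lead's stub `stub_junctionRoughnessLTE`: for the pinned chain
`P = pinnedChain ω₂ lam β γ` (`ω₂, T > 0`, `lam, β ≥ 0`, `N, M ≥ 2`), ANY `h ∈ L²(μ_T)` and every probe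
temperature `θ`, with `Π = condK` (redraw of the two junction momenta `p_{N−1}, p_N` from `N(0,T)`),
`k_s = p_s² − T`, `τ₁ = ∫ h k_{N−1} dμ_T`, `τ₂ = ∫ h k_N dμ_T`:

  `roughness P T N M (h − θ e_K) = roughness P T N M h − θ(τ₁+τ₂)/T² + θ²/T²`
  `= (θ − (τ₁+τ₂)/2)²/T² + (τ₁−τ₂)²/(4T²) + (roughness P T N M h − (τ₁²+τ₂²)/(2T²))`.

Ingredients (all folklore Gaussian algebra under the junction redraw of
`…InsertionGibbsProduct.lean`): `Π e_K = 1/T` pointwise (`∫ ξ_s² dN(0,T)^{⊗L} = T`), hence a.e.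
`(h − θe_K) − Π(h − θe_K) = (h − Πh) − θ (k_{N−1} + k_N)/(2T²)`; `Πh ⟂ k_s` for `s ∈ {N−1, N}`
(pull back along the measure-preserving redraw, `Πh` does not see the redrawn momenta, and
`∫ (ξ_s² − T) dN(0,T)^{⊗L} = 0`); `‖k_{N−1} + k_N‖² = 4T²` (`integral_kinPair_sq`). No definitions;
nothing is taken as a named fact.
-/

noncomputable section

open MeasureTheory Filter Topology ProbabilityTheory
open scoped ContDiff NNReal ENNReal
open Literature.MathematicalPhysics.KineticTheory.HeatConduction

namespace Summit.AtomisticToContinuum.FouriersLaw.Cruxes.SuperadditiveResistance.ThermaliseThenCutProbeInsertion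

open InsertionToolbox InsertionToolbox.Assembly
open Summit.AtomisticToContinuum.FouriersLaw.Theorems.SuperadditiveResistance.Kubo
  (memLp_kinetic memLp_momentum gauss_ibp integral_sq_mul_gibbsDensity_eq)

section Split

variable {ω₂ lam β : ℝ} {N M : ℕ}

/-! ### Second moments of the redraw law `N(0,T)^{⊗L}` -/

/-- `∫ ξ_a² dN(0,T)^{⊗L}(ξ) = T` (`T ≥ 0`). -/
theorem split_integral_eval_sq_pi {L : ℕ} {T : ℝ} (hT : 0 ≤ T) (a : Fin L) :
    ∫ ξ : Fin L → ℝ, ξ a ^ 2 ∂(Measure.pi fun _ : Fin L => gaussianReal 0 T.toNNReal) = T := by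
  rw [integral_comp_eval (μ := fun _ : Fin L => gaussianReal 0 T.toNNReal) (i := a)
    (f := fun s : ℝ => s ^ 2) (by fun_prop)]
  have h := variance_of_integral_eq_zero (μ := gaussianReal 0 T.toNNReal) (X := fun x : ℝ => x)
    measurable_id.aemeasurable integral_id_gaussianReal
  rw [variance_fun_id_gaussianReal, Real.coe_toNNReal _ hT] at h
  exact h.symm

/-- `ξ ↦ ξ_a²` is integrable under `N(0,T)^{⊗L}`. -/
theorem split_integrable_eval_sq_pi {L : ℕ} (T : ℝ) (a : Fin L) :
    Integrable (fun ξ : Fin L → ℝ => ξ a ^ 2)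
      (Measure.pi fun _ : Fin L => gaussianReal 0 T.toNNReal) := by
  refine integrable_comp_eval (μ := fun _ : Fin L => gaussianReal 0 T.toNNReal) (i := a)
    (f := fun s : ℝ => s ^ 2) ?_
  have h := (memLp_id_gaussianReal' (μ := 0) (v := T.toNNReal) 2 (by simp)).integrable_sq
  simpa using h

/-! ### The redraw `Π_K` on `e_K` and its (a.e.) linearity -/

/-- `Π_K f` does not see the junction momenta: redrawing them first changes nothing (pointwise). -/
theorem split_condK_redraw (T : ℝ) (f : PhaseSpace (N + M) → ℝ) (x : PhaseSpace (N + M))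
    (ξ : Fin (N + M) → ℝ) :
    condK T N M f (x.1, fun i => if i.val = N - 1 ∨ i.val = N then ξ i else x.2 i) =
      condK T N M f x := by
  unfold condK
  congr 1; funext ξ'; congr 1
  refine Prod.ext rfl (funext fun i => ?_)
  by_cases hi : i.val = N - 1 ∨ i.val = N
  · simp only [hi, if_true]
  · simp only [hi, if_false]

/-- `e_K` after the redraw: `e_K(q, merge_K(ξ, p)) = (ξ²_{N−1} + ξ²_N)/(2T²)`. -/
theorem split_eK_redraw (hN : 1 ≤ N) (hM : 1 ≤ M) (T : ℝ) (x : PhaseSpace (N + M))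
    (ξ : Fin (N + M) → ℝ) :
    eK T N M (x.1, fun i => if i.val = N - 1 ∨ i.val = N then ξ i else x.2 i) =
      1 / (2 * T ^ 2) * ξ ⟨N - 1, by omega⟩ ^ 2 + 1 / (2 * T ^ 2) * ξ ⟨N, by omega⟩ ^ 2 := by
  unfold eK
  rw [kin_eq_sq_line (s := N - 1) (by omega), kin_eq_sq_line (s := N) (by omega)]
  simp only [true_or, or_true, if_true]
  ring

/-- The fibre of `e_K` under the redraw is integrable. -/
theorem split_integrable_eK_fibre (hN : 1 ≤ N) (hM : 1 ≤ M) (T : ℝ) (x : PhaseSpace (N + M)) :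
    Integrable (fun ξ : Fin (N + M) → ℝ =>
        eK T N M (x.1, fun i => if i.val = N - 1 ∨ i.val = N then ξ i else x.2 i))
      (Measure.pi fun _ : Fin (N + M) => gaussianReal 0 T.toNNReal) := by
  simp_rw [split_eK_redraw hN hM T x]
  exact ((split_integrable_eval_sq_pi T _).const_mul _).add
    ((split_integrable_eval_sq_pi T _).const_mul _)

/-- **`Π_K e_K = 1/T`** (pointwise; `T > 0`, `N, M ≥ 1`): each redrawn momentum has `E ξ² = T`. -/
theorem split_condK_eK (hN : 1 ≤ N) (hM : 1 ≤ M) {T : ℝ} (hT : 0 < T) (x : PhaseSpace (N + M)) :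
    condK T N M (eK T N M) x = 1 / T := by
  unfold condK
  simp_rw [split_eK_redraw hN hM T x]
  rw [integral_add ((split_integrable_eval_sq_pi T _).const_mul _)
    ((split_integrable_eval_sq_pi T _).const_mul _), integral_const_mul, integral_const_mul,
    split_integral_eval_sq_pi hT.le, split_integral_eval_sq_pi hT.le]
  field_simp; ring

/-- Linearity of `Π_K` at a point where both fibres are integrable. -/
theorem split_condK_sub_const_mul_apply {T : ℝ} {f g : PhaseSpace (N + M) → ℝ} {x : PhaseSpace (N + M)}
    (hf : Integrable (fun ξ : Fin (N + M) → ℝ =>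
        f (x.1, fun i => if i.val = N - 1 ∨ i.val = N then ξ i else x.2 i))
      (Measure.pi fun _ : Fin (N + M) => gaussianReal 0 T.toNNReal))
    (hg : Integrable (fun ξ : Fin (N + M) → ℝ =>
        g (x.1, fun i => if i.val = N - 1 ∨ i.val = N then ξ i else x.2 i))
      (Measure.pi fun _ : Fin (N + M) => gaussianReal 0 T.toNNReal)) (θ : ℝ) :
    condK T N M (fun y => f y - θ * g y) x = condK T N M f x - θ * condK T N M g x := by
  unfold condK
  rw [← integral_const_mul, ← integral_sub hf (hg.const_mul θ)]

/-- **A.e. linearity of the redraw on `h − θ e_K`**: for `h ∈ L²(μ_T)`, for `μ_T`-a.e. `x`,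
`Π_K(h − θ e_K)(x) = Π_K h(x) − θ/T` (the `h`-fibre is integrable a.e. by Fubini along the
measure-preserving redraw). -/
theorem split_condK_sub_ae (hω : 0 < ω₂) (hl : 0 ≤ lam) (hb : 0 ≤ β) (γ : ℝ) (hN : 1 ≤ N)
    (hM : 1 ≤ M) {T : ℝ} (hT : 0 < T) {h : PhaseSpace (N + M) → ℝ}
    (hh : MemLp h 2 ((pinnedChain ω₂ lam β γ).gibbsMeasure (N + M) T)) (θ : ℝ) :
    ∀ᵐ x ∂((pinnedChain ω₂ lam β γ).gibbsMeasure (N + M) T),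
      condK T N M (fun y => h y - θ * eK T N M y) x = condK T N M h x - θ / T := by
  haveI := pinnedChain_isProbabilityMeasure_gibbsMeasure hω hl hb γ (N + M) hT
  have hΨ := pinnedChain_measurePreserving_redraw hω hl hb γ (N + M) hT
    (fun i : Fin (N + M) => i.val = N - 1 ∨ i.val = N)
  have hL2 := hh.comp_measurePreserving hΨ
  have hF1 := hL2.integrable one_le_two
  filter_upwards [hF1.prod_right_ae] with x hx
  rw [split_condK_sub_const_mul_apply hx (split_integrable_eK_fibre hN hM T x) θ,
    split_condK_eK hN hM hT x]
  ring

/-! ### `Π_K h ⟂ k_s` for the redrawn sites -/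

/-- **`range Π_K ⟂ (p_s² − T)` for `s ∈ {N−1, N}`**: for `h ∈ L²(μ_T)`,
`∫ (Π_K h)(p_s² − T) dμ_T = 0` — pull back along the measure-preserving redraw; `Π_K h` does not
see the redrawn momentum, whose law `N(0,T)` has `E(ξ² − T) = 0`. -/
theorem split_integral_condK_mul_kin (hω : 0 < ω₂) (hl : 0 ≤ lam) (hb : 0 ≤ β) (γ : ℝ) {T : ℝ}
    (hT : 0 < T) {s : ℕ} (hsK : s = N - 1 ∨ s = N) (hs : s < N + M)
    {h : PhaseSpace (N + M) → ℝ} (hh : MemLp h 2 ((pinnedChain ω₂ lam β γ).gibbsMeasure (N + M) T)) :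
    ∫ x, condK T N M h x * (kin (N + M) s x - T) ∂((pinnedChain ω₂ lam β γ).gibbsMeasure (N + M) T) =
      0 := by
  haveI := pinnedChain_isProbabilityMeasure_gibbsMeasure hω hl hb γ (N + M) hT
  set μ := (pinnedChain ω₂ lam β γ).gibbsMeasure (N + M) T with hμ
  set γL : Measure (Fin (N + M) → ℝ) := Measure.pi fun _ : Fin (N + M) => gaussianReal 0 T.toNNReal
    with hγL
  have hΨ := pinnedChain_measurePreserving_redraw hω hl hb γ (N + M) hT
    (fun i : Fin (N + M) => i.val = N - 1 ∨ i.val = N)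
  have hPi : MemLp (condK T N M h) 2 μ :=
    (memLp_condK_and_integral_sq_le hω hl hb γ (N + M) hT
      (fun i : Fin (N + M) => i.val = N - 1 ∨ i.val = N) hh).1
  have hk : MemLp (fun x => kin (N + M) s x - T) 2 μ := memLp_kin_sub_line hω hl hb γ hs hT
  have hG : Integrable (fun x => condK T N M h x * (kin (N + M) s x - T)) μ := hPi.integrable_mul hk
  have e1 : ∫ x, condK T N M h x * (kin (N + M) s x - T) ∂μ =
      ∫ z, condK T N M h z.1 * (z.2 ⟨s, hs⟩ ^ 2 - T) ∂(μ.prod γL) := by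
    have e := integral_map (μ := μ.prod γL) hΨ.measurable.aemeasurable
      (f := fun x => condK T N M h x * (kin (N + M) s x - T))
      (by rw [hΨ.map_eq]; exact hG.aestronglyMeasurable)
    rw [hΨ.map_eq] at e
    rw [e]
    refine integral_congr_ae (ae_of_all _ fun z => ?_)
    simp only
    rw [split_condK_redraw, kin_eq_sq_line hs]
    simp only [hsK, if_true]
  have e2 : ∫ ξ, (ξ ⟨s, hs⟩ ^ 2 - T) ∂γL = 0 := by
    rw [integral_sub (split_integrable_eval_sq_pi T _) (integrable_const T),
      split_integral_eval_sq_pi hT.le, integral_const]; simp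
  rw [e1, integral_prod_mul (μ := μ) (ν := γL) (condK T N M h) (fun ξ => ξ ⟨s, hs⟩ ^ 2 - T), e2,
    mul_zero]

/-! ### Gaussian moments at two momenta (for Bessel) -/

/-- `∫ (p_a² − T)² dμ_T = 2T²` (Gaussian integration by parts, `gauss_ibp`). -/
theorem split_integral_kinetic_sq (hω : 0 < ω₂) (hl : 0 ≤ lam) (hb : 0 ≤ β) (γ : ℝ) {L : ℕ}
    {T : ℝ} (hT : 0 < T) (a : Fin L) :
    ∫ x, (x.2 a ^ 2 - T) * (x.2 a ^ 2 - T) ∂((pinnedChain ω₂ lam β γ).gibbsMeasure L T) =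
      2 * T ^ 2 := by
  have hka : MemLp (fun x : PhaseSpace L => x.2 a ^ 2 - T) 2 ((pinnedChain ω₂ lam β γ).gibbsMeasure L T) :=
    memLp_kinetic hω hl hb L hT a
  have hpa : MemLp (fun x : PhaseSpace L => x.2 a) 2 ((pinnedChain ω₂ lam β γ).gibbsMeasure L T) :=
    memLp_momentum hω hl hb L hT a
  have hC1 : ContDiff ℝ 1 (fun y : PhaseSpace L => y.2 a ^ 2 - T) := by fun_prop
  have hd : partialP a (fun y : PhaseSpace L => y.2 a ^ 2 - T) = fun x => 2 * x.2 a := by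
    funext x; rw [partialP_kinetic_coord, if_pos rfl]
  have m := gauss_ibp hω hl hb L hT a hC1 hka (by rw [hd]; exact hpa.const_mul 2)
  rw [hd] at m
  have hZ : 0 < ∫ x, (pinnedChain ω₂ lam β γ).gibbsDensity L T x :=
    integral_exp_pos (pinnedChain_integrable_gibbsDensity hω hl hb γ L hT)
  rw [(pinnedChain ω₂ lam β γ).integral_gibbsMeasure, m]
  have e : (fun x : PhaseSpace L => x.2 a * (2 * x.2 a) * (pinnedChain ω₂ lam β γ).gibbsDensity L T x) =
      fun x => 2 * (x.2 a ^ 2 * (pinnedChain ω₂ lam β γ).gibbsDensity L T x) := by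
    funext x; ring
  rw [e, integral_const_mul, integral_sq_mul_gibbsDensity_eq (γ := γ) hω hl hb L hT a]
  field_simp

/-- `∫ (p_a² − T)(p_b² − T) dμ_T = 0` for `a ≠ b` (Gaussian integration by parts in `p_a`). -/
theorem split_integral_kinetic_mul_kinetic (hω : 0 < ω₂) (hl : 0 ≤ lam) (hb : 0 ≤ β) (γ : ℝ) {L : ℕ}
    {T : ℝ} (hT : 0 < T) {a b : Fin L} (hab : b ≠ a) :
    ∫ x, (x.2 a ^ 2 - T) * (x.2 b ^ 2 - T) ∂((pinnedChain ω₂ lam β γ).gibbsMeasure L T) = 0 := by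
  haveI := pinnedChain_isProbabilityMeasure_gibbsMeasure hω hl hb γ L hT
  have hkb : MemLp (fun x : PhaseSpace L => x.2 b ^ 2 - T) 2 ((pinnedChain ω₂ lam β γ).gibbsMeasure L T) :=
    memLp_kinetic hω hl hb L hT b
  have hC1 : ContDiff ℝ 1 (fun y : PhaseSpace L => y.2 b ^ 2 - T) := by fun_prop
  have hd : partialP a (fun y : PhaseSpace L => y.2 b ^ 2 - T) = fun _ => 0 := by
    funext x; rw [partialP_kinetic_coord, if_neg hab]
  have m := gauss_ibp hω hl hb L hT a hC1 hkb (by rw [hd]; exact memLp_const 0)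
  rw [hd] at m
  rw [(pinnedChain ω₂ lam β γ).integral_gibbsMeasure, m]
  simp

end Split

/-! ### The registered helper -/

/-- **Helper `helper_roughnessSplit` (exact Hermite split of the lead's stub `stub_junctionRoughnessLTE`).**
For the pinned chain (`ω₂, T > 0`, `lam, β ≥ 0`, `N, M ≥ 2`), any `h ∈ L²(μ_T)` and every `θ`, with
`τ₁ = ∫ h (p²_{N−1} − T) dμ_T`, `τ₂ = ∫ h (p²_N − T) dμ_T`:
`v_K(h − θ e_K) = (θ − (τ₁+τ₂)/2)²/T² + (τ₁−τ₂)²/(4T²) + (v_K(h) − (τ₁²+τ₂²)/(2T²))`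
(`= v_K(h) − θ(τ₁+τ₂)/T² + θ²/T²`: `Π_K e_K = 1/T`, `(I − Π_K)e_K = (k_{N−1}+k_N)/(2T²) ⟂ range Π_K`,
`‖(I − Π_K)e_K‖² = 1/T²`, `⟨h, (I − Π_K)e_K⟩ = (τ₁+τ₂)/(2T²)`). -/
theorem helper_roughnessSplit : ∀ (ω₂ lam β γ T : ℝ), 0 < ω₂ → 0 ≤ lam → 0 ≤ β → 0 < T → ∀ (N M : ℕ), 2 ≤ N → 2 ≤ M → ∀ (h : PhaseSpace (N + M) → ℝ), MemLp h 2 ((pinnedChain ω₂ lam β γ).gibbsMeasure (N + M) T) → ∀ θ : ℝ, roughness (pinnedChain ω₂ lam β γ) T N M (fun x => h x - θ * eK T N M x) = (θ - ((∫ x, h x * (kin (N + M) (N - 1) x - T) ∂((pinnedChain ω₂ lam β γ).gibbsMeasure (N + M) T)) + (∫ x, h x * (kin (N + M) N x - T) ∂((pinnedChain ω₂ lam β γ).gibbsMeasure (N + M) T))) / 2) ^ 2 / T ^ 2 + ((∫ x, h x * (kin (N + M) (N - 1) x - T) ∂((pinnedChain ω₂ lam β γ).gibbsMeasure (N + M)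 T)) - (∫ x, h x * (kin (N + M) N x - T) ∂((pinnedChain ω₂ lam β γ).gibbsMeasure (N + M) T))) ^ 2 / (4 * T ^ 2) + (roughness (pinnedChain ω₂ lam β γ) T N M h - ((∫ x, h x * (kin (N + M) (N - 1) x - T) ∂((pinnedChain ω₂ lam β γ).gibbsMeasure (N + M) T)) ^ 2 + (∫ x, h x * (kin (N + M) N x - T) ∂((pinnedChain ω₂ lam β γ).gibbsMeasure (N + M) T)) ^ 2) / (2 * T ^ 2)) := by
  intro ω₂ lam β γ T hω hl hb hT N M hN hM h hh θ
  haveI := pinnedChain_isProbabilityMeasure_gibbsMeasure hω hl hb γ (N + M) hT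
  have hN1 : 1 ≤ N := by omega
  have hM1 : 1 ≤ M := by omega
  have ha : N - 1 < N + M := by omega
  have hb' : N < N + M := by omega
  set μ := (pinnedChain ω₂ lam β γ).gibbsMeasure (N + M) T with hμ
  set τ₁ := ∫ x, h x * (kin (N + M) (N - 1) x - T) ∂μ with hτ₁
  set τ₂ := ∫ x, h x * (kin (N + M) N x - T) ∂μ with hτ₂
  -- `L²` facts
  have hPi : MemLp (condK T N M h) 2 μ :=
    (memLp_condK_and_integral_sq_le hω hl hb γ (N + M) hT
      (fun i : Fin (N + M) => i.val = N - 1 ∨ i.val = N) hh).1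
  have hk1 : MemLp (fun x => kin (N + M) (N - 1) x - T) 2 μ := memLp_kin_sub_line hω hl hb γ ha hT
  have hk2 : MemLp (fun x => kin (N + M) N x - T) 2 μ := memLp_kin_sub_line hω hl hb γ hb' hT
  set u : PhaseSpace (N + M) → ℝ := fun x => h x - condK T N M h x with hu_def
  set w : PhaseSpace (N + M) → ℝ := fun x =>
    1 / (2 * T ^ 2) * ((kin (N + M) (N - 1) x - T) + (kin (N + M) N x - T)) with hw_def
  have hu : MemLp u 2 μ := hh.sub hPi
  have hw : MemLp w 2 μ := (hk1.add hk2).const_mul _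
  -- (1) the deviation of `h − θ e_K` from its redraw, a.e.
  have hdev : ∀ᵐ x ∂μ, ((h x - θ * eK T N M x) - condK T N M (fun y => h y - θ * eK T N M y) x) ^ 2 =
      (u x - θ * w x) ^ 2 := by
    filter_upwards [split_condK_sub_ae hω hl hb γ hN1 hM1 hT hh θ] with x hx
    rw [hx]
    simp only [hu_def, hw_def]
    unfold eK
    congr 1
    field_simp
    ring
  have hR : roughness (pinnedChain ω₂ lam β γ) T N M (fun x => h x - θ * eK T N M x) =
      ∫ x, (u x - θ * w x) ^ 2 ∂μ := by
    unfold roughness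
    exact integral_congr_ae hdev
  -- (2) expand the square
  have i_uu : Integrable (fun x => u x ^ 2) μ := hu.integrable_sq
  have i_uw : Integrable (fun x => u x * w x) μ := hu.integrable_mul hw
  have hexp : ∫ x, (u x - θ * w x) ^ 2 ∂μ =
      (∫ x, u x ^ 2 ∂μ) - 2 * θ * (∫ x, u x * w x ∂μ) + θ ^ 2 * ∫ x, w x ^ 2 ∂μ := by
    have e : (fun x => (u x - θ * w x) ^ 2) =
        fun x => (u x ^ 2 - 2 * θ * (u x * w x)) + θ ^ 2 * w x ^ 2 := by funext x; ring
    have i1 : Integrable (fun x => u x ^ 2 - 2 * θ * (u x * w x)) μ := i_uu.sub (i_uw.const_mul _)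
    have i2 : Integrable (fun x => θ ^ 2 * w x ^ 2) μ := hw.integrable_sq.const_mul _
    rw [e, integral_add i1 i2, integral_sub i_uu (i_uw.const_mul _), integral_const_mul,
      integral_const_mul]
  -- (3) the three moments
  have I1 : ∫ x, u x ^ 2 ∂μ = roughness (pinnedChain ω₂ lam β γ) T N M h := rfl
  have I3 : ∫ x, w x ^ 2 ∂μ = 1 / T ^ 2 := by
    have e : (fun x => w x ^ 2) = fun x =>
        (1 / (2 * T ^ 2)) ^ 2 * ((kin (N + M) (N - 1) x - T) + (kin (N + M) N x - T)) ^ 2 := by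
      funext x; simp only [hw_def]; ring
    rw [e, integral_const_mul, integral_kinPair_sq hω hl hb γ hT hN1 hM1]
    field_simp; ring
  have I2 : ∫ x, u x * w x ∂μ = (τ₁ + τ₂) / (2 * T ^ 2) := by
    have ihw : Integrable (fun x => h x * w x) μ := hh.integrable_mul hw
    have iPw : Integrable (fun x => condK T N M h x * w x) μ := hPi.integrable_mul hw
    have e : (fun x => u x * w x) = fun x => h x * w x - condK T N M h x * w x := by
      funext x; simp only [hu_def]; ring
    rw [e, integral_sub ihw iPw]
    have o1 := split_integral_condK_mul_kin hω hl hb γ hT (N := N) (M := M) (Or.inl rfl) ha hh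
    have o2 := split_integral_condK_mul_kin hω hl hb γ hT (N := N) (M := M) (Or.inr rfl) hb' hh
    have hPw0 : ∫ x, condK T N M h x * w x ∂μ = 0 := by
      have e' : (fun x => condK T N M h x * w x) = fun x =>
          1 / (2 * T ^ 2) * (condK T N M h x * (kin (N + M) (N - 1) x - T)) +
            1 / (2 * T ^ 2) * (condK T N M h x * (kin (N + M) N x - T)) := by
        funext x; simp only [hw_def]; ring
      have iPk1 : Integrable (fun x => condK T N M h x * (kin (N + M) (N - 1) x - T)) μ :=
        hPi.integrable_mul hk1
      have iPk2 : Integrable (fun x => condK T N M h x * (kin (N + M) N x - T)) μ :=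
        hPi.integrable_mul hk2
      rw [e', integral_add (iPk1.const_mul _) (iPk2.const_mul _), integral_const_mul,
        integral_const_mul, o1, o2]
      ring
    have hhw : ∫ x, h x * w x ∂μ = (τ₁ + τ₂) / (2 * T ^ 2) := by
      have e' : (fun x => h x * w x) = fun x =>
          1 / (2 * T ^ 2) * (h x * (kin (N + M) (N - 1) x - T)) +
            1 / (2 * T ^ 2) * (h x * (kin (N + M) N x - T)) := by
        funext x; simp only [hw_def]; ring
      have ihk1 : Integrable (fun x => h x * (kin (N + M) (N - 1) x - T)) μ := hh.integrable_mul hk1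
      have ihk2 : Integrable (fun x => h x * (kin (N + M) N x - T)) μ := hh.integrable_mul hk2
      rw [e', integral_add (ihk1.const_mul _) (ihk2.const_mul _), integral_const_mul,
        integral_const_mul]
      ring
    rw [hhw, hPw0, sub_zero]
  rw [hR, hexp, I1, I2, I3]
  field_simp; ring

/-- **Helper `helper_roughnessBessel` (Bessel's inequality in `(range Π_K)^⊥`).** For the pinned chain
(`ω₂, T > 0`, `lam, β ≥ 0`, `N, M ≥ 2`) and any `h ∈ L²(μ_T)`: `(τ₁² + τ₂²)/(2T²) ≤ v_K(h)`,
`τ₁ = ∫ h (p²_{N−1} − T) dμ_T`, `τ₂ = ∫ h (p²_N − T) dμ_T` — the directions `k_{N−1}/(√2 T)`,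
`k_N/(√2 T)` are orthonormal (`E k_s² = 2T²`, `E k_{N−1} k_N = 0`), orthogonal to `range Π_K`, and
`⟨(I − Π_K)h, k_s⟩ = τ_s`; expand `0 ≤ ‖(I − Π_K)h − (τ₁ k_{N−1} + τ₂ k_N)/(2T²)‖²`. -/
theorem helper_roughnessBessel : ∀ (ω₂ lam β γ T : ℝ), 0 < ω₂ → 0 ≤ lam → 0 ≤ β → 0 < T → ∀ (N M : ℕ), 2 ≤ N → 2 ≤ M → ∀ (h : PhaseSpace (N + M) → ℝ), MemLp h 2 ((pinnedChain ω₂ lam β γ).gibbsMeasure (N + M) T) → ((∫ x, h x * (kin (N + M) (N - 1) x - T) ∂((pinnedChain ω₂ lam β γ).gibbsMeasure (N + M) T)) ^ 2 + (∫ x, h x * (kin (N + M) N x - T) ∂((pinnedChain ω₂ lam β γ).gibbsMeasure (N + M) T)) ^ 2) / (2 * T ^ 2) ≤ roughness (pinnedChain ω₂ lam β γ) T N M h := by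
  intro ω₂ lam β γ T hω hl hb hT N M hN hM h hh
  haveI := pinnedChain_isProbabilityMeasure_gibbsMeasure hω hl hb γ (N + M) hT
  have ha : N - 1 < N + M := by omega
  have hb' : N < N + M := by omega
  have hne : (⟨N, hb'⟩ : Fin (N + M)) ≠ ⟨N - 1, ha⟩ := fun h' => by
    have := Fin.mk.inj_iff.mp h'; omega
  set μ := (pinnedChain ω₂ lam β γ).gibbsMeasure (N + M) T with hμ
  set τ₁ := ∫ x, h x * (kin (N + M) (N - 1) x - T) ∂μ with hτ₁
  set τ₂ := ∫ x, h x * (kin (N + M) N x - T) ∂μ with hτ₂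
  have hPi : MemLp (condK T N M h) 2 μ :=
    (memLp_condK_and_integral_sq_le hω hl hb γ (N + M) hT
      (fun i : Fin (N + M) => i.val = N - 1 ∨ i.val = N) hh).1
  set k₁ : PhaseSpace (N + M) → ℝ := fun x => kin (N + M) (N - 1) x - T with hk₁_def
  set k₂ : PhaseSpace (N + M) → ℝ := fun x => kin (N + M) N x - T with hk₂_def
  have hk1 : MemLp k₁ 2 μ := memLp_kin_sub_line hω hl hb γ ha hT
  have hk2 : MemLp k₂ 2 μ := memLp_kin_sub_line hω hl hb γ hb' hT
  set u : PhaseSpace (N + M) → ℝ := fun x => h x - condK T N M h x with hu_def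
  have hu : MemLp u 2 μ := hh.sub hPi
  -- Gaussian moments of the pair
  have m11 : ∫ x, k₁ x * k₁ x ∂μ = 2 * T ^ 2 := by
    simp only [hk₁_def, kin_eq_sq_line ha]
    exact split_integral_kinetic_sq hω hl hb γ hT _
  have m22 : ∫ x, k₂ x * k₂ x ∂μ = 2 * T ^ 2 := by
    simp only [hk₂_def, kin_eq_sq_line hb']
    exact split_integral_kinetic_sq hω hl hb γ hT _
  have m12 : ∫ x, k₁ x * k₂ x ∂μ = 0 := by
    simp only [hk₁_def, hk₂_def, kin_eq_sq_line ha, kin_eq_sq_line hb']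
    exact split_integral_kinetic_mul_kinetic hω hl hb γ hT hne
  -- the two pairings of `(I − Π_K) h`
  have p1 : ∫ x, u x * k₁ x ∂μ = τ₁ := by
    have e : (fun x => u x * k₁ x) = fun x => h x * k₁ x - condK T N M h x * k₁ x := by
      funext x; simp only [hu_def]; ring
    have i1 : Integrable (fun x => h x * k₁ x) μ := hh.integrable_mul hk1
    have i2 : Integrable (fun x => condK T N M h x * k₁ x) μ := hPi.integrable_mul hk1
    rw [e, integral_sub i1 i2]
    simp only [hk₁_def]
    rw [split_integral_condK_mul_kin hω hl hb γ hT (N := N) (M := M) (s := N - 1) (Or.inl rfl) ha hh,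
      sub_zero]
  have p2 : ∫ x, u x * k₂ x ∂μ = τ₂ := by
    have e : (fun x => u x * k₂ x) = fun x => h x * k₂ x - condK T N M h x * k₂ x := by
      funext x; simp only [hu_def]; ring
    have i1 : Integrable (fun x => h x * k₂ x) μ := hh.integrable_mul hk2
    have i2 : Integrable (fun x => condK T N M h x * k₂ x) μ := hPi.integrable_mul hk2
    rw [e, integral_sub i1 i2]
    simp only [hk₂_def]
    rw [split_integral_condK_mul_kin hω hl hb γ hT (N := N) (M := M) (s := N) (Or.inr rfl) hb' hh,
      sub_zero]
  -- `0 ≤ ‖u − a k₁ − b k₂‖²`, expanded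
  set a : ℝ := τ₁ / (2 * T ^ 2) with ha_def
  set b : ℝ := τ₂ / (2 * T ^ 2) with hb_def
  have key : 0 ≤ ∫ x, (u x - a * k₁ x - b * k₂ x) ^ 2 ∂μ := integral_nonneg fun x => sq_nonneg _
  have i0 : Integrable (fun x => u x ^ 2) μ := hu.integrable_sq
  have i1 : Integrable (fun x => (-2 * a) * (u x * k₁ x)) μ := (hu.integrable_mul hk1).const_mul _
  have i2 : Integrable (fun x => (-2 * b) * (u x * k₂ x)) μ := (hu.integrable_mul hk2).const_mul _
  have i3 : Integrable (fun x => a ^ 2 * (k₁ x * k₁ x)) μ := (hk1.integrable_mul hk1).const_mul _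
  have i4 : Integrable (fun x => b ^ 2 * (k₂ x * k₂ x)) μ := (hk2.integrable_mul hk2).const_mul _
  have i5 : Integrable (fun x => (2 * a * b) * (k₁ x * k₂ x)) μ := (hk1.integrable_mul hk2).const_mul _
  have s1 : Integrable (fun x => u x ^ 2 + (-2 * a) * (u x * k₁ x)) μ := i0.add i1
  have s2 : Integrable (fun x => u x ^ 2 + (-2 * a) * (u x * k₁ x) + (-2 * b) * (u x * k₂ x)) μ :=
    s1.add i2
  have s3 : Integrable (fun x => u x ^ 2 + (-2 * a) * (u x * k₁ x) + (-2 * b) * (u x * k₂ x) +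
      a ^ 2 * (k₁ x * k₁ x)) μ := s2.add i3
  have s4 : Integrable (fun x => u x ^ 2 + (-2 * a) * (u x * k₁ x) + (-2 * b) * (u x * k₂ x) +
      a ^ 2 * (k₁ x * k₁ x) + b ^ 2 * (k₂ x * k₂ x)) μ := s3.add i4
  have e : (fun x => (u x - a * k₁ x - b * k₂ x) ^ 2) = fun x =>
      u x ^ 2 + (-2 * a) * (u x * k₁ x) + (-2 * b) * (u x * k₂ x) +
        a ^ 2 * (k₁ x * k₁ x) + b ^ 2 * (k₂ x * k₂ x) + (2 * a * b) * (k₁ x * k₂ x) := by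
    funext x; ring
  rw [e, integral_add s4 i5, integral_add s3 i4, integral_add s2 i3, integral_add s1 i2,
    integral_add i0 i1, integral_const_mul, integral_const_mul, integral_const_mul,
    integral_const_mul, integral_const_mul, p1, p2, m11, m22, m12] at key
  have I1 : ∫ x, u x ^ 2 ∂μ = roughness (pinnedChain ω₂ lam β γ) T N M h := rfl
  rw [I1] at key
  have hT2 : 0 < 2 * T ^ 2 := by positivity
  have eab : (τ₁ ^ 2 + τ₂ ^ 2) / (2 * T ^ 2) =
      -((-2 * a) * τ₁ + (-2 * b) * τ₂ + a ^ 2 * (2 * T ^ 2) + b ^ 2 * (2 * T ^ 2)) := by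
    simp only [ha_def, hb_def]; field_simp; ring
  rw [eab]; linarith

end Summit.AtomisticToContinuum.FouriersLaw.Cruxes.SuperadditiveResistance.ThermaliseThenCutProbeInsertion

end
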